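import Mathlib.Analysis.Complex.ReImTopology
import Literature.Probability.RandomPlanarGeometry.PlanarDomainsTopology
import Literature.Topology.PlaneTopology.JordanCurveProofs
import HarnessLib

/-!
# Sets fenced by the closure of a Jordan domain lie inside it

Topic: Probability / RandomPlanarGeometry (companion to `PlanarDomains.lean`,
`PlanarDomainsTopology.lean`). `PlanarDomainsTopology.lean` identifies, *assuming* the Jordan
curve theorem `(hJ : JordanCurveTheorem)`, the carrier of an `Literature.Probability.RandomPlanarGeometry.JordanDomain` with the inside
of its boundary curve and `(closure D)ᶜ` with the connected unbounded outside
(`JordanDomain.exterior_of_JCT`, `frontier_subset_closure_exterior`). Feeding in the proof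
`Literature.Topology.PlaneTopology.JordanCurveTheorem_holds` (`JordanCurveProofs.lean`) we derive unconditionally:

* `JordanDomain.interior_subset_of_frontier_subset_closure`: a *bounded* set whose frontier
  lies in `closure D` has its interior inside `D` and its closure inside `closure D` (the
  connected unbounded exterior misses its frontier, so misses it);
* `JordanDomain.openRect_subset_of_sides_subset_closure`: an axis-parallel open rectangle whose
  four sides lie in `closure D` lies in `D` — used for the faces of the discrete domain `Ω_δ`,
  whose edges are the lattice segments contained in `closure D` (`DomainDiscretisation.lean`);
* `JordanDomain.inter_frontier_nonempty_of_isPreconnected`: a connected set meeting `D` and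
  its complement meets the boundary curve (no JCT needed).

Everything is proved; the statements are folklore consequences of the Jordan curve theorem
(e.g. Newman, *Elements of the topology of plane sets of points* (1951), Ch. V §10).
-/

noncomputable section

open Set Topology Complex Bornology

namespace Literature.Probability.RandomPlanarGeometry

namespace JordanDomain

variable (D : JordanDomain)

/-- **Sets fenced by the closure lie inside.** If `S` is bounded and its frontier lies in
`closure D`, then `interior S ⊆ D` and `closure S ⊆ closure D`: the exterior `(closure D)ᶜ`
is connected, unbounded (`exterior_of_JCT` with `JordanCurveTheorem_holds`) and misses
`frontier S`, so it lies in `(closure S)ᶜ`; and an interior point of `S` on the boundary curve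
would be a limit of exterior points (`frontier_subset_closure_exterior`). [folklore] -/
theorem interior_subset_of_frontier_subset_closure {S : Set ℂ} (hS : IsBounded S)
    (hfr : frontier S ⊆ closure D.carrier) :
    interior S ⊆ D.carrier ∧ closure S ⊆ closure D.carrier := by
  obtain ⟨hE, -, hEb⟩ := D.exterior_of_JCT Literature.Topology.PlaneTopology.JordanCurveTheorem_holds
  -- the exterior misses `frontier S`, so sits in `interior S` or in `(closure S)ᶜ`
  have hE2 : (closure D.carrier)ᶜ ⊆ interior S ∪ (closure S)ᶜ := by
    intro z hz
    by_cases h1 : z ∈ closure S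
    · left
      by_contra h2
      exact hz (hfr ⟨h1, h2⟩)
    · exact Or.inr h1
  have hdisj : Disjoint (interior S) (closure S)ᶜ :=
    Set.disjoint_left.2 fun z hz hz' => hz' (interior_subset_closure hz)
  have hEout : (closure D.carrier)ᶜ ⊆ (closure S)ᶜ := by
    rcases hE.isPreconnected.subset_or_subset isOpen_interior isClosed_closure.isOpen_compl hdisj
      hE2 with h | h
    · exact absurd ((hS.closure.subset interior_subset_closure).subset h) hEb
    · exact h
  have hcl : closure S ⊆ closure D.carrier := by
    intro z hz
    by_contra h
    exact hEout h hz
  refine ⟨fun z hz => ?_, hcl⟩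
  have hz' : z ∈ closure D.carrier := hcl (interior_subset_closure hz)
  rw [closure_eq_self_union_frontier] at hz'
  rcases hz' with h | h
  · exact h
  · exfalso
    -- `z` is a limit of exterior points, but `interior S` is a neighbourhood missing them
    have hmem := D.frontier_subset_closure_exterior Literature.Topology.PlaneTopology.JordanCurveTheorem_holds h
    rw [mem_closure_iff_nhds] at hmem
    obtain ⟨w, hwS, hwE⟩ := hmem (interior S) (isOpen_interior.mem_nhds hz)
    exact hEout hwE (interior_subset_closure hwS)

/-- **Rectangles with sides in the closure.** If the four sides of the axis-parallel rectangle
`[x₁, x₂] × [y₁, y₂]` lie in `closure D`, the open rectangle `(x₁, x₂) × (y₁, y₂)` lies in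
`D`. [folklore] -/
theorem openRect_subset_of_sides_subset_closure {x₁ x₂ y₁ y₂ : ℝ}
    (hv : ∀ z : ℂ, (z.re = x₁ ∨ z.re = x₂) → y₁ ≤ z.im → z.im ≤ y₂ → z ∈ closure D.carrier)
    (hh : ∀ z : ℂ, (z.im = y₁ ∨ z.im = y₂) → x₁ ≤ z.re → z.re ≤ x₂ → z ∈ closure D.carrier) :
    (Ioo x₁ x₂ ×ℂ Ioo y₁ y₂) ⊆ D.carrier := by
  set S : Set ℂ := Icc x₁ x₂ ×ℂ Icc y₁ y₂ with hS
  have hSb : IsBounded S := (Metric.isBounded_Icc x₁ x₂).reProdIm (Metric.isBounded_Icc y₁ y₂)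
  have hfr : frontier S ⊆ closure D.carrier := by
    intro z hz
    rw [hS, frontier_reProdIm, closure_Icc, closure_Icc] at hz
    have hfI : ∀ {a b : ℝ} {t : ℝ}, t ∈ frontier (Icc a b) → t ∈ Icc a b ∧ (t = a ∨ t = b) := by
      intro a b t ht
      have h1 : t ∈ Icc a b := by
        have := frontier_subset_closure ht
        rwa [closure_Icc] at this
      refine ⟨h1, ?_⟩
      have h2 : t ∉ Ioo a b := by
        intro h2
        have : t ∈ interior (Icc a b) := by rw [interior_Icc]; exact h2
        exact (disjoint_interior_frontier (s := Icc a b)).le_bot ⟨this, ht⟩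
      by_contra h3
      push Not at h3
      exact h2 ⟨lt_of_le_of_ne h1.1 (Ne.symm h3.1), lt_of_le_of_ne h1.2 h3.2⟩
    rcases hz with ⟨hre, him⟩ | ⟨hre, him⟩
    · obtain ⟨him1, him2⟩ := hfI him
      exact hh z him2 hre.1 hre.2
    · obtain ⟨hre1, hre2⟩ := hfI hre
      exact hv z hre2 him.1 him.2
  have key := (D.interior_subset_of_frontier_subset_closure hSb hfr).1
  refine Subset.trans ?_ key
  rw [hS, interior_reProdIm, interior_Icc, interior_Icc]

/-- **A connected set joining `D` to its complement meets the boundary curve** (no Jordan curve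
theorem needed: `D` and `(closure D)ᶜ` are disjoint open sets). [folklore] -/
theorem inter_frontier_nonempty_of_isPreconnected {c : Set ℂ} (hc : IsPreconnected c)
    (h1 : (c ∩ D.carrier).Nonempty) (h2 : (c ∩ D.carrierᶜ).Nonempty) :
    (c ∩ frontier D.carrier).Nonempty := by
  by_contra h
  rw [not_nonempty_iff_eq_empty] at h
  have hsub : c ⊆ D.carrier ∪ (closure D.carrier)ᶜ := by
    intro z hz
    by_cases hz1 : z ∈ closure D.carrier
    · rw [closure_eq_self_union_frontier] at hz1
      rcases hz1 with h' | h'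
      · exact Or.inl h'
      · exfalso
        have : z ∈ c ∩ frontier D.carrier := ⟨hz, h'⟩
        rw [h] at this
        exact this
    · exact Or.inr hz1
  have hdisj : Disjoint D.carrier (closure D.carrier)ᶜ :=
    Set.disjoint_left.2 fun z hz hz' => hz' (subset_closure hz)
  rcases hc.subset_or_subset D.isOpen isClosed_closure.isOpen_compl hdisj hsub with h' | h'
  · obtain ⟨z, hz, hz'⟩ := h2
    exact hz' (h' hz)
  · obtain ⟨z, hz, hz'⟩ := h1
    exact (h' hz) (subset_closure hz')

end JordanDomain

end Literature.Probability.RandomPlanarGeometry
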